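import Literature.Claims.NS.Aksman2026
import Literature.Claims.NS.ClayR3HorizonBridge
import HarnessLib

/-!
# C175 `Aksman2026` — SALVAGE, TRUE column (D-0090 NS-CLAIMS; salvage seat `ns-claims-salvage-p3`)

Kernel record for the TRUE content of the last link of the printed chain of
`Literature.Claims.NS.Aksman2026` (Zenodo 21263950, Thm 11 proof p.6 l.25–27 «The uniform gradient bound
holds branchwise (Section 9), satisfying BKM. Consequently, the tree is … globally smooth» + face (iv)
«A globally smooth solution exists for u0, satisfying the exact Millennium Prize formulation»), typed as the
binder `Literature.Claims.NS.Aksman2026.Step_BKM`.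

WHAT IS TRUE, AND PROVED HERE (no new definition, standard axioms): for `ν > 0` and a Clay datum `u₀`
(smooth, divergence-free, rapidly decaying), ANY global classical solution `(U, P)` of the unforced system on
`[0, ∞) × ℝ³` with `U 0 = u₀` whose energy is finite on every closed slab `[0, T]` makes `(ν, 0, u₀)`
Clay-solvable (`clay_solvable_of_global_finiteEnergy`) — by the tree's horizon bridge
`ClayVariants.clayR3_solvable_zero_iff_forall_Icc_of_rapidDecay` (Tao 2013 Cor. 11.4 / Lemma 8.1 packaging:
a finite-energy smooth solution on every `[0, T]` ⇔ Fefferman (A) for that datum) applied to the restrictions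
`U|[0,T]` (`IsClassicalNSSolutionOn.mono`). NO gradient bound is needed for this; hence the FINITE-ENERGY
TWIN of the binder, `step_BKM_of_finiteEnergy` (the printed «satisfying BKM ⇒ globally smooth ⇒ (iv)» for
solutions of finite energy), is a theorem, and so is the twin with the binder's own bounded-gradient clause
kept (`step_BKM_twin`). The binder `Step_BKM` ITSELF quantifies over ALL classical solutions from `u₀`
(`IsClassicalNSSolutionOn` carries no energy/decay clause — CARD §3 Δ5: the print states no energy or
pressure condition); it is not discharged here and nothing in this file asserts it (records: from the zero
datum the linear strain flows `U(t,x) = φ(t)·diag(1,1,−2)x`, `φ(0) = 0`, are global classical solutions with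
uniformly bounded gradient and infinite energy — the class the binder quantifies over is wider than the
physical one; `Literature.Analysis.FluidPDE.LinearFlow` vocabulary).

WHAT THIS IS NOT: not a claim about NS regularity or blow-up; not a claim about any author beyond the
typed locator.
-/

noncomputable section

set_option linter.dupNamespace false

open Set MeasureTheory
open scoped Topology ENNReal NNReal ContDiff

namespace Summit.NavierStokesRegularity.NavierStokesRegularity.Theorems.Aksman2026Salvage

open Literature.Analysis.FluidPDE Literature.Claims.NS Literature.Claims.NS.Aksman2026
  Literature.Claims.NS.ClayVariants

/-- **A global finite-energy classical solution from a Clay datum makes the datum Clay-solvable** (the TRUE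
content of «globally smooth ⇒ the exact Millennium Prize formulation», Thm 11 (iv)): for `ν > 0`, `u₀` smooth,
divergence-free and rapidly decaying, and `(U, P)` a classical solution of the unforced Navier–Stokes system on
`[0, ∞) × ℝ³` with `U 0 = u₀` and `sup_{t ≤ T} ∫|U(t)|² < ∞` for every `T > 0`, the Cauchy problem
`(ν, 0, u₀)` is solvable in the Clay (A) sense. Proof: restrict to each closed slab `[0, T]`
(`IsClassicalNSSolutionOn.mono`, `Icc 0 T ⊆ Ici 0`) and apply the horizon bridge
`clayR3_solvable_zero_iff_forall_Icc_of_rapidDecay`. [cite: Aksman2026, Thm 11 (iv) and proof p.6 l.21–27]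
[cite: Tao2013Localisation, Cor. 11.4, Lemma 8.1] [cite: FeffermanClay2006, (A) with (4) (6) (7) p. 2] -/
theorem clay_solvable_of_global_finiteEnergy {ν : ℝ} (hν : 0 < ν) {u₀ : E3 → E3}
    (hu₀ : ContDiff ℝ ∞ u₀) (hdec : HasRapidSpatialDecay u₀) {U : ℝ → E3 → E3} {P : ℝ → E3 → ℝ}
    (hcl : IsClassicalNSSolutionOn (Ici 0) ν 0 U P) (hU0 : U 0 = u₀)
    (hE : ∀ T : ℝ, 0 < T → ∃ A : ℝ≥0∞, A < ⊤ ∧ ∀ t ∈ Icc 0 T, ∫⁻ x, ‖U t x‖ₑ ^ 2 ≤ A) :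
    clayR3.Solvable ν 0 u₀ := by
  refine (clayR3_solvable_zero_iff_forall_Icc_of_rapidDecay hν (hu₀.of_le (by norm_cast)) hdec).2
    fun T hT => ⟨U, P, ?_, hU0, hE T hT⟩
  exact hcl.mono (fun t ht => mem_Ici.2 ht.1) (uniqueDiffOn_Icc hT)

/-- **FINITE-ENERGY TWIN of the binder `Step_BKM`** — the printed last link «satisfying BKM. Consequently …
globally smooth … (iv)» read for solutions of finite energy on every slab: TRUE, and the bounded-gradient
clause is not even used. (The binder itself quantifies over all classical solutions, with no energy clause —
Δ5 — and is NOT asserted here.) [cite: Aksman2026, Thm 11 proof p.6 l.25–27; §9 p.6 l.12–16] -/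
theorem step_BKM_of_finiteEnergy :
    ∀ ν : ℝ, 0 < ν → ∀ u₀ : E3 → E3, ContDiff ℝ ∞ u₀ → NSWave0.IsDivFree u₀ → HasRapidSpatialDecay u₀ →
      (∃ (U : ℝ → E3 → E3) (P : ℝ → E3 → ℝ), IsClassicalNSSolutionOn (Ici 0) ν 0 U P ∧ U 0 = u₀ ∧
          ∀ T : ℝ, 0 < T → ∃ A : ℝ≥0∞, A < ⊤ ∧ ∀ t ∈ Icc 0 T, ∫⁻ x, ‖U t x‖ₑ ^ 2 ≤ A) →
        clayR3.Solvable ν 0 u₀ := by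
  intro ν hν u₀ hu₀ _hdiv hdec ⟨U, P, hcl, hU0, hE⟩
  exact clay_solvable_of_global_finiteEnergy hν hu₀ hdec hcl hU0 hE

/-- **The binder's shape with the energy clause added** (bounded gradient kept, as printed in (ii)/(12)):
TRUE. [cite: Aksman2026, Thm 11 (ii) p.6 l.19–20 and proof l.25–27] -/
theorem step_BKM_twin :
    ∀ ν : ℝ, 0 < ν → ∀ u₀ : E3 → E3, ContDiff ℝ ∞ u₀ → NSWave0.IsDivFree u₀ → HasRapidSpatialDecay u₀ →
      (∃ (U : ℝ → E3 → E3) (P : ℝ → E3 → ℝ), IsClassicalNSSolutionOn (Ici 0) ν 0 U P ∧ U 0 = u₀ ∧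
          (∃ K : ℝ, ∀ t : ℝ, 0 ≤ t → ∀ x : E3, ‖fderiv ℝ (U t) x‖ ≤ K) ∧
          ∀ T : ℝ, 0 < T → ∃ A : ℝ≥0∞, A < ⊤ ∧ ∀ t ∈ Icc 0 T, ∫⁻ x, ‖U t x‖ₑ ^ 2 ≤ A) →
        clayR3.Solvable ν 0 u₀ := by
  intro ν hν u₀ hu₀ _hdiv hdec ⟨U, P, hcl, hU0, _hK, hE⟩
  exact clay_solvable_of_global_finiteEnergy hν hu₀ hdec hcl hU0 hE

/-- Conversely the binder `Step_BKM` trivially IMPLIES its finite-energy twin (it asks less of `U`); recorded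
so that the relation between the typed binder and the TRUE twin is a kernel statement.
[cite: Aksman2026, Thm 11 proof p.6 l.25–27] -/
theorem step_BKM_twin_of_step_BKM (h : Step_BKM) :
    ∀ ν : ℝ, 0 < ν → ∀ u₀ : E3 → E3, ContDiff ℝ ∞ u₀ → NSWave0.IsDivFree u₀ → HasRapidSpatialDecay u₀ →
      (∃ (U : ℝ → E3 → E3) (P : ℝ → E3 → ℝ), IsClassicalNSSolutionOn (Ici 0) ν 0 U P ∧ U 0 = u₀ ∧
          (∃ K : ℝ, ∀ t : ℝ, 0 ≤ t → ∀ x : E3, ‖fderiv ℝ (U t) x‖ ≤ K) ∧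
          ∀ T : ℝ, 0 < T → ∃ A : ℝ≥0∞, A < ⊤ ∧ ∀ t ∈ Icc 0 T, ∫⁻ x, ‖U t x‖ₑ ^ 2 ≤ A) →
        clayR3.Solvable ν 0 u₀ :=
  fun ν hν u₀ hu₀ hdiv hdec ⟨U, P, hcl, hU0, hK, _⟩ => h ν hν u₀ hu₀ hdiv hdec ⟨U, P, hcl, hU0, hK⟩

end Summit.NavierStokesRegularity.NavierStokesRegularity.Theorems.Aksman2026Salvage

end

-- WHAT THIS IS NOT: not a claim about NS regularity or blow-up; not a claim about any author beyond the typed locator.
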